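import Summits.QuantumFields.YangMills.Theses.UnitScaleTilt

/-!
# Crux `HistoryTailL` (stmt-QuantumFields-19936) — LINE «entropy-floor» (ideator seat ym-r3-idea-2 g4, lens «nearmiss»)

THE FLOOR OF THE PER-PLAQUETTE FAMILY.  The landed union-bound schema (`T3AveragedTailProfile.historyTailAt_of_perPlaquette`) asks a
per-plaquette large-field tail that is GAUSSIAN IN THE THRESHOLD, `C·β_i^A·exp(−c·p(g_i)²)` — super-exponential in the height `i = K − j`
(exponent `≍ (i·log L)^(2p₀)`, `p₀ > 2`).  Measured deficit: the union over the `≤ 72·L^(3(m+i))` plaquettes of height `i` and the tail sums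
over `i ≥ K/m` converge as soon as the per-plaquette probability of the Bałaban-threshold event decays GEOMETRICALLY IN THE HEIGHT with a
ratio beating the plaquette entropy: `Gibbs_K{θ_i ≤ |Ū^{j}(∂p) − 1|} ≤ D·ρ^i`, `ρ·L³ < 1`.  That is the weakest per-plaquette currency that
closes `HistoryTailL`; every other line's currency is a SUFFICIENT condition for it (Gaussian schema ⇒ floor; `ModerateWindow.WindowMGFL` ⇒
`StretchedTail.OrliczTailL` ⇒ floor, by Chebyshev and «stretched-exponential beats geometric» once `α·p₀ ≥ 1`).

Stubs: `stub_geometricTail` (the floor statement — ALL the located difficulty, at deep heights `i` small relative to `j`) and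
`stub_historyTailOfGeometric` (M, provable now: union bound `T3CruxEstimates.real_not_plaqSmall_comp_le_sum` pulled back along the `j`-fold
averaging, `#Plaq ≤ 9·(2L^(m+K−j))³`, geometric profile `q(i) = 72·D·L^(3m)·(ρL³)^i` is summable with summable tail sums ⇒ `AveragedTailAt` ⇒
`T3BareTailProfile.historyTailAt_of_averagedTailAt`; `γ₁ ↦ min γ₁ 1`).  Composition `HistoryTailL_of` kernel-checked.  Sorries ONLY in `stub_*`.
No summit, no rung (`YM3TorusSU2`), no mass gap is proved; `HistoryTailL` stays open behind `stub_geometricTail`.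
Instrument row (falsifier of the floor): measured frequency of the threshold event per plaquette at heights `i = 1..4`, `K = 5..7`, against
`L^(−3i)`: a ratio not decaying in `i` at fixed `K − i` pattern refutes every per-plaquette line at once.
-/

namespace Summit.QuantumFields.YangMills.Cruxes.HistoryTailL.EntropyFloor

open scoped BigOperators Topology Classical MeasureTheory ProbabilityTheory Matrix
open Filter Set Function TopologicalSpace MeasureTheory

/-! ## §1 The registered stubs (the ONLY sorries) -/

/-- STUB 1 (XL, the floor crux): GEOMETRIC RATE IN THE HEIGHT for the Bałaban-threshold event of one block-averaged plaquette, uniformly in the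
cut-off `K` and the height, with ratio `ρ < L⁻³` (beats plaquette entropy); thresholds enlargeable as `HistoryTailL` requires. -/
theorem stub_geometricTail :
    open Literature.MathematicalPhysics.QuantumFieldTheory.Balaban1983to89 Literature.MathematicalPhysics.QuantumFieldTheory.Balaban1983to89.T3ContinuumYM3Torus
      Literature.MathematicalPhysics.QuantumFieldTheory.Balaban1983to89.T3UnitScaleTilt Literature.MathematicalPhysics.QuantumFieldTheory.Balaban1983to89.T3UnitLawDensityEML in
    ∀ (L : ℕ) (b₁ p₁ : ℝ), ∃ (b₀ p₀ : ℝ), b₁ ≤ b₀ ∧ p₁ ≤ p₀ ∧ 0 < b₀ ∧ 2 < p₀ ∧ ∃ γ₁ : ℝ, 0 < γ₁ ∧ γ₁ ≤ 1 ∧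
      ∀ (F : T3Family) (γ : ℝ), F.L = L → 0 < γ → γ ≤ γ₁ → ∃ (D ρ : ℝ), 0 ≤ D ∧ 0 ≤ ρ ∧ ρ * (L : ℝ) ^ 3 < 1 ∧
        ∀ (K j : ℕ), 1 ≤ j → j ≤ K → ∀ (p : Plaq (F.P K) j),
          (gibbsK F ℰp γ K).real {U | θBal F.L γ b₀ p₀ (K - j) ≤
              GaugeGroup.dist1 (GaugeField.plaqHol (Averaging.iter (fun i => BlockAveraging.blockAvg (P := F.P K) (j := i) ℰp) j U) p)}
            ≤ D * ρ ^ (K - j) := by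
  sorry

/-- STUB 2 (M, provable now — the bookkeeping): the floor currency closes `HistoryTailL` (union bound over the plaquettes of each height, geometric
profile with summable tail sums ⇒ `AveragedTailAt` ⇒ `historyTailAt_of_averagedTailAt`). -/
theorem stub_historyTailOfGeometric :
    open Literature.MathematicalPhysics.QuantumFieldTheory.Balaban1983to89 Literature.MathematicalPhysics.QuantumFieldTheory.Balaban1983to89.T3ContinuumYM3Torus
      Literature.MathematicalPhysics.QuantumFieldTheory.Balaban1983to89.T3UnitScaleTilt Literature.MathematicalPhysics.QuantumFieldTheory.Balaban1983to89.T3UnitLawDensityEML in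
    (∀ (L : ℕ) (b₁ p₁ : ℝ), ∃ (b₀ p₀ : ℝ), b₁ ≤ b₀ ∧ p₁ ≤ p₀ ∧ 0 < b₀ ∧ 2 < p₀ ∧ ∃ γ₁ : ℝ, 0 < γ₁ ∧ γ₁ ≤ 1 ∧
      ∀ (F : T3Family) (γ : ℝ), F.L = L → 0 < γ → γ ≤ γ₁ → ∃ (D ρ : ℝ), 0 ≤ D ∧ 0 ≤ ρ ∧ ρ * (L : ℝ) ^ 3 < 1 ∧
        ∀ (K j : ℕ), 1 ≤ j → j ≤ K → ∀ (p : Plaq (F.P K) j),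
          (gibbsK F ℰp γ K).real {U | θBal F.L γ b₀ p₀ (K - j) ≤
              GaugeGroup.dist1 (GaugeField.plaqHol (Averaging.iter (fun i => BlockAveraging.blockAvg (P := F.P K) (j := i) ℰp) j U) p)}
            ≤ D * ρ ^ (K - j)) →
    Summit.QuantumFields.YangMills.Theses.UnitScaleTilt.HistoryTailL := by
  sorry

/-! ## §2 The crux BY NAME — no sorry below this line -/

/-- `UnitScaleTilt.HistoryTailL` BY NAME from the two stubs. -/
theorem HistoryTailL_of : Summit.QuantumFields.YangMills.Theses.UnitScaleTilt.HistoryTailL :=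
  stub_historyTailOfGeometric stub_geometricTail

end Summit.QuantumFields.YangMills.Cruxes.HistoryTailL.EntropyFloor
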